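import Summits.QuantumAdvantage.QuantumAdvantage.Theses.LinnikCubicClassGroups
import Summits.QuantumAdvantage.QuantumAdvantage.Theorems.LinnikCubicClassGroupsPureCubicClassGroupFBQPStubPacking
import Summits.QuantumAdvantage.QuantumAdvantage.Theorems.LinnikCubicClassGroupsPureCubicClassGroupFBQPStubRegulatorPeriod
import Summits.QuantumAdvantage.QuantumAdvantage.Theorems.LinnikCubicClassGroupsPureCubicClassGroupFBQPStubVoronoiChain
import Literature.NumberTheory.CubicFields.VoronoiChainRescale
import Literature.NumberTheory.CubicFields.VoronoiChainFilter

/-!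
# Crux `LinnikCubicClassGroups.PureCubicClassGroupFBQP` (stmt-QuantumAdvantage-11544) — stub `stub_cubicFilteredCycle`

Line `arakelov-giant-step-cycle`, stub `stub_cubicFilteredCycle` (S3b-T3a): THE FILTERED VORONOI CHAIN
of a nonzero fractional ideal `I` of a cubic field `K` with a real embedding `σ₁` and a non-real
embedding `σ₂` (Hallgren-style infrastructure with ONE gap `≥ log (11/10)`). Write
`θ = voronoiChain σ₁ σ₂ I x₀` for the chain of positive relative minima through `x₀`
(`Literature/NumberTheory/CubicFields/VoronoiChain.lean`). Assembly of:

* (a) the period: `θ (i + n₀) = ε θ i`, `n₀ ≥ 1`, for the least unit `ε` with `σ₁ ε > 1`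
  (`stub_regulatorPeriod`, `voronoiChain_periodic`, `voronoiChain_shift_pos`), and
  `n₀ log 2 ≤ 6 R` from the six-gap (`voronoiChain_six_gap` ∘ `stub_packing`);
* (b)–(c) the increasing enumeration `s` of the BIG-GAP indices (`11 σ₁θ(j) ≤ 10 σ₁θ(j+1)`), its
  six-step spacing, its period `nS`, and the filtered gap bounds `[log(11/10), 6 log(3√|d_K|)]`
  (the real-variable skeleton `Literature/…/VoronoiChainFilter.lean` applied to `a i = σ₁ θ(i)`,
  with the Minkowski one-step bound `voronoiChain_gap_le`);
* (d), (f) the reduced labels `θ(s i)⁻¹ I ∋ 1` and the rescaled chains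
  (`Literature/…/VoronoiChainRescale.lean`);
* (e) exact repetition of the labels with period `nS`: equal labels iff the generators differ by a
  unit (`spanSingleton_inv_mul_eq_iff`), a unit with `σ₁ > 0` is `ε ^ n` (`unit_eq_zpow_of_pos`,
  Dirichlet in signature `(1,1)` via `exists_one_lt_log_eq_regulator`), and `ε ^ n θ(s i) =
  θ(s i + n n₀) = θ(s (i + n nS))`.
-/

namespace Summit.QuantumAdvantage.QuantumAdvantage.Theorems.LinnikCubicClassGroups

open scoped NumberField nonZeroDivisors
open NumberField
open Literature.NumberTheory.CubicFields

/-- **Units with positive real conjugate are powers of the regulator unit.** In a cubic field with a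
real embedding `σ₁` and a non-real `σ₂`, if `ε` is a unit with `σ₁ ε > 1` and `log σ₁ ε = R_K`, then
every unit `u` with `σ₁ u > 0` is `ε ^ n` for some `n : ℤ` (as elements of `K`): by
`exists_one_lt_log_eq_regulator`, `|σ₁ u| = c ^ n` with `c > 1`, `log c = R_K`, so `c = σ₁ ε`. -/
theorem unit_eq_zpow_of_pos {K : Type} [Field K] [NumberField K] (hdeg : Module.finrank ℚ K = 3)
    (σ₁ : K →+* ℝ) (σ₂ : K →+* ℂ) (hσ₂ : ∃ z : K, starRingEnd ℂ (σ₂ z) ≠ σ₂ z) {ε : (𝓞 K)ˣ}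
    (hε : 1 < σ₁ (algebraMap (𝓞 K) K ε))
    (hreg : Real.log (σ₁ (algebraMap (𝓞 K) K ε)) = NumberField.Units.regulator K)
    (u : (𝓞 K)ˣ) (hu : 0 < σ₁ (algebraMap (𝓞 K) K u)) :
    ∃ n : ℤ, algebraMap (𝓞 K) K u = (algebraMap (𝓞 K) K ε) ^ n := by
  obtain ⟨c, hc1, hcreg, -, hpow⟩ := exists_one_lt_log_eq_regulator hdeg σ₁ σ₂ hσ₂
  have hcε : c = σ₁ (algebraMap (𝓞 K) K ε) :=
    Real.log_injOn_pos (Set.mem_Ioi.mpr (by linarith)) (Set.mem_Ioi.mpr (by linarith))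
      (by rw [hcreg, hreg])
  obtain ⟨n, hn⟩ := hpow u
  refine ⟨n, σ₁.injective ?_⟩
  have hn' : |σ₁ (algebraMap (𝓞 K) K u)| = c ^ n := hn
  rw [abs_of_pos hu] at hn'
  rw [map_zpow₀, ← hcε]
  exact hn'

/-- **S3b-T3a `stub_cubicFilteredCycle`** (number theory only, over the tree's `voronoiChain`/`posRelMinima` and
the landed `stub_voronoiChain`). For a cubic field with a real embedding `σ₁` and a non-real `σ₂`, a nonzero fractional
ideal `I` and a base minimum `x₀`, write `θ = voronoiChain σ₁ σ₂ I x₀`. Then: `θ` is purely periodic under the regulator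
unit `ε` with period `n₀`, `n₀ log 2 ≤ 6 R`; the indices followed by a BIG GAP (`11 σ₁θ(j) ≤ 10 σ₁θ(j+1)`) are enumerated
increasingly by `s : ℤ → ℤ` (normalised by `s 0 =` the least nonnegative one), consecutive ones at most `6` apart (six-gap:
among six consecutive gaps one has ratio `≥ 2^{1/6} > 11/10`), `s (i + nS) = s i + n₀`; filtered gaps lie in
`[log(11/10), 6 log(3√|d_K|)]`; the reduced ideals `J i = θ(s i)⁻¹ I` contain `1` as a minimum, repeat exactly with
period `nS` (equal ideals ⇔ quotient of generators a positive unit ⇔ a power of `ε`), and the chain of `θ(i)⁻¹ I` from `1`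
is `k ↦ θ(i)⁻¹ θ(i+k)` (chains rescale). [Voronoi 1896; Delone–Faddeev Ch. IV; Buchmann–Williams 1988 §2] -/
theorem stub_cubicFilteredCycle :
    ∀ (K : Type) [Field K] [NumberField K], Module.finrank ℚ K = 3 →
    ∀ (σ₁ : K →+* ℝ) (σ₂ : K →+* ℂ), (∃ z : K, starRingEnd ℂ (σ₂ z) ≠ σ₂ z) →
    ∀ (I : FractionalIdeal (𝓞 K)⁰ K), I ≠ 0 → ∀ x₀ : K, x₀ ∈ posRelMinima σ₁ σ₂ I →
    ∃ (s : ℤ → ℤ) (n₀ nS : ℕ) (ε : (𝓞 K)ˣ),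
      0 < n₀ ∧ 1 < σ₁ ((ε : 𝓞 K) : K) ∧ Real.log (σ₁ ((ε : 𝓞 K) : K)) = NumberField.Units.regulator K ∧
      (∀ i, voronoiChain σ₁ σ₂ I x₀ (i + n₀) = ((ε : 𝓞 K) : K) * voronoiChain σ₁ σ₂ I x₀ i) ∧
      (n₀ : ℝ) * Real.log 2 ≤ 6 * NumberField.Units.regulator K ∧
      StrictMono s ∧
      (∀ i, 11 * σ₁ (voronoiChain σ₁ σ₂ I x₀ (s i)) ≤ 10 * σ₁ (voronoiChain σ₁ σ₂ I x₀ (s i + 1))) ∧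
      (∀ j, 11 * σ₁ (voronoiChain σ₁ σ₂ I x₀ j) ≤ 10 * σ₁ (voronoiChain σ₁ σ₂ I x₀ (j + 1)) → ∃ i, s i = j) ∧
      0 ≤ s 0 ∧ (∀ j, 0 ≤ j → 11 * σ₁ (voronoiChain σ₁ σ₂ I x₀ j) ≤ 10 * σ₁ (voronoiChain σ₁ σ₂ I x₀ (j + 1)) → s 0 ≤ j) ∧
      (∀ i, s (i + 1) ≤ s i + 6) ∧
      0 < nS ∧ (∀ i, s (i + nS) = s i + n₀) ∧
      (∀ i, Real.log (11 / 10) ≤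
        Real.log (σ₁ (voronoiChain σ₁ σ₂ I x₀ (s (i + 1)))) - Real.log (σ₁ (voronoiChain σ₁ σ₂ I x₀ (s i)))) ∧
      (∀ i, Real.log (σ₁ (voronoiChain σ₁ σ₂ I x₀ (s (i + 1)))) - Real.log (σ₁ (voronoiChain σ₁ σ₂ I x₀ (s i))) ≤
        6 * Real.log (3 * Real.sqrt |(NumberField.discr K : ℝ)|)) ∧
      (∀ i, (1 : K) ∈ posRelMinima σ₁ σ₂ (FractionalIdeal.spanSingleton (𝓞 K)⁰ (voronoiChain σ₁ σ₂ I x₀ (s i))⁻¹ * I)) ∧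
      (∀ i j, FractionalIdeal.spanSingleton (𝓞 K)⁰ (voronoiChain σ₁ σ₂ I x₀ (s i))⁻¹ * I =
          FractionalIdeal.spanSingleton (𝓞 K)⁰ (voronoiChain σ₁ σ₂ I x₀ (s j))⁻¹ * I ↔ (nS : ℤ) ∣ i - j) ∧
      (∀ (i k : ℤ), voronoiChain σ₁ σ₂ (FractionalIdeal.spanSingleton (𝓞 K)⁰ (voronoiChain σ₁ σ₂ I x₀ i)⁻¹ * I) 1 k =
          (voronoiChain σ₁ σ₂ I x₀ i)⁻¹ * voronoiChain σ₁ σ₂ I x₀ (i + k)) := by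
  intro K _ _ hdeg σ₁ σ₂ hσ₂ I hI x₀ hx₀
  obtain ⟨ε, hε, hreg, -⟩ := stub_regulatorPeriod K hdeg σ₁ σ₂ hσ₂
  have hε' : 1 < σ₁ (algebraMap (𝓞 K) K ε) := hε
  have hε0 : 0 < σ₁ (algebraMap (𝓞 K) K ε) := by linarith
  have hεne : algebraMap (𝓞 K) K ε ≠ 0 := (map_ne_zero σ₁).mp hε0.ne'
  have hreg' : Real.log (σ₁ (algebraMap (𝓞 K) K ε)) = NumberField.Units.regulator K := hreg
  -- (a) the period of the named chain under `ε`
  obtain ⟨c, hc⟩ := voronoiChain_periodic hdeg hσ₂ ε hε' hx₀ ε hε0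
  have hcpos : 0 < c := voronoiChain_shift_pos hdeg hσ₂ ε hε' hx₀ ε hε' hc
  have hcn : ((c.toNat : ℕ) : ℤ) = c := Int.toNat_of_nonneg hcpos.le
  have hmem := fun i => voronoiChain_mem hdeg hσ₂ ε hε' hx₀ i
  have hpos : ∀ i, 0 < σ₁ (voronoiChain σ₁ σ₂ I x₀ i) := fun i => (hmem i).2
  have hmono := voronoiChain_strictMono hdeg hσ₂ ε hε' hx₀
  have h6 : ∀ i, 2 * σ₁ (voronoiChain σ₁ σ₂ I x₀ i) ≤ σ₁ (voronoiChain σ₁ σ₂ I x₀ (i + 6)) :=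
    fun i => voronoiChain_six_gap hdeg hσ₂ ε hε' stub_packing hx₀ i
  have hperK : ∀ i, voronoiChain σ₁ σ₂ I x₀ (i + (c.toNat : ℕ)) =
      algebraMap (𝓞 K) K ε * voronoiChain σ₁ σ₂ I x₀ i := by
    intro i
    rw [hcn]
    exact hc i
  have hper : ∀ i, σ₁ (voronoiChain σ₁ σ₂ I x₀ (i + (c.toNat : ℕ))) =
      σ₁ (algebraMap (𝓞 K) K ε) * σ₁ (voronoiChain σ₁ σ₂ I x₀ i) := by
    intro i
    rw [hperK, map_mul]
  -- the Minkowski one-step bound, with `B = 3 √|d_K| ≥ 1`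
  have hB : (1 : ℝ) ≤ 3 * Real.sqrt |(NumberField.discr K : ℝ)| := by
    have h1 : (1 : ℝ) ≤ Real.sqrt |(NumberField.discr K : ℝ)| := by
      rw [Real.one_le_sqrt]
      have h0 : (1 : ℤ) ≤ |NumberField.discr K| := Int.one_le_abs (NumberField.discr_ne_zero K)
      have : ((1 : ℤ) : ℝ) ≤ ((|NumberField.discr K| : ℤ) : ℝ) := by exact_mod_cast h0
      simpa [Int.cast_abs] using this
    linarith
  have hgap : ∀ i, σ₁ (voronoiChain σ₁ σ₂ I x₀ (i + 1)) ≤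
      3 * Real.sqrt |(NumberField.discr K : ℝ)| * σ₁ (voronoiChain σ₁ σ₂ I x₀ i) :=
    fun i => voronoiChain_gap_le hdeg hσ₂ ε hε' hI hx₀ i
  -- (b) the enumeration of the big-gap indices
  obtain ⟨s, nS, hsm, hbig, hsurj, hs0, hs0min, h6s, hnS, hnSper⟩ :=
    exists_bigGap_enumeration (a := fun i => σ₁ (voronoiChain σ₁ σ₂ I x₀ i)) hpos h6
      (Nat.pos_of_ne_zero (by omega) : 0 < c.toNat) hper
  refine ⟨s, c.toNat, nS, ε, by omega, hε, hreg, hperK, ?_, hsm, hbig, hsurj, hs0, hs0min, h6s, hnS,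
    hnSper, fun i => log_sub_log_ge_of_bigGap hpos hmono hsm hbig i,
    fun i => log_sub_log_le_of_gap_le hpos hB hgap hsm h6s i,
    fun i => one_mem_posRelMinima_inv_mul (hmem (s i)), fun i j => ?_,
    fun i k => voronoiChain_inv_mul hdeg hσ₂ ε hε' hx₀ i k⟩
  · -- `n₀ log 2 ≤ 6 R`
    have h := mul_log_two_le_of_six_gap hpos h6 hper
    rw [hreg'] at h
    exact h
  · -- (e) the labels `θ(s i)⁻¹ I` repeat exactly with period `nS`
    have hsper : ∀ i k : ℤ, s (i + k * nS) = s i + k * c := fun i k => by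
      have h := apply_add_mul_of_forall_apply_add hnSper i k
      rw [hcn] at h
      exact h
    have hθper : ∀ i k : ℤ, voronoiChain σ₁ σ₂ I x₀ (i + k * c) =
        (algebraMap (𝓞 K) K ε) ^ k * voronoiChain σ₁ σ₂ I x₀ i :=
      eq_zpow_mul_of_forall_apply_add hεne hc
    rw [spanSingleton_inv_mul_eq_iff hI (hmem (s j)).1.2.1]
    constructor
    · rintro ⟨u, hu⟩
      have hupos : 0 < σ₁ (algebraMap (𝓞 K) K u) := by
        have h1 := hpos (s j)
        rw [hu, map_mul] at h1
        exact (mul_pos_iff_of_pos_right (hpos (s i))).mp h1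
      obtain ⟨n, hn⟩ := unit_eq_zpow_of_pos hdeg σ₁ σ₂ hσ₂ hε' hreg' u hupos
      have e1 : voronoiChain σ₁ σ₂ I x₀ (s j) = voronoiChain σ₁ σ₂ I x₀ (s (i + n * nS)) := by
        rw [hsper, hθper, ← hn, ← hu]
      have e2 : s j = s (i + n * nS) := hmono.injective (congrArg σ₁ e1)
      have e3 : j = i + n * nS := hsm.injective e2
      exact ⟨-n, by rw [e3]; ring⟩
    · rintro ⟨k, hk⟩
      refine ⟨ε ^ (-k), ?_⟩
      have e3 : j = i + (-k) * nS := by linarith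
      rw [e3, hsper, hθper]
      congr 1
      exact (NumberField.Units.coe_zpow ε (-k)).symm

end Summit.QuantumAdvantage.QuantumAdvantage.Theorems.LinnikCubicClassGroups
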